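import Summits.ResolutionOfSingularities.ResolutionOfSingularities.Theorems.FrobeniusClosingSteerWords13WanderForest
import Summits.ResolutionOfSingularities.ResolutionOfSingularities.Theorems.FrobeniusClosingSteerThreadKoenig

/-!
# Crux `Steer` (stmt-ResolutionOfSingularities-16345), line `switching-dichotomy` — WORDS 14: §σ2.19 (res-L0-w41-tri-2's first-step audit words) and §σ2.22 THE THREAD SPLIT (res-L0-w41-strat-2; plan-1 RULING 16c) of the p = 2 σ_top-STEERED COMPOSITION (HOIST of the registered skeleton r38 cc5f2c8f0939be83, l.1727–2014, inside `section SteeredTwo`)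

Holder res-L0-w41-lead-1 g5 on res-L0-w41-plan-1 RULING 47 (E1) / 104b; see `…Words01Core` for the hoist protocol (bodies byte for byte;
`[cite: …]` / `[folklore]` tags on CLOSED `def … : Prop` words are written «(ref. …)» / «(folklore)» — GATE NOTE of `…Words02Stubs`;
cite keys inside `[cite:]` tags normalised to `references.bib` keys where needed, as in `…Words03Phases`).
Nothing here is a statement of the manuscript [claim: Hironaka2017, status: under-review]. OURS (candidates / vocabulary; AI review is
weaker than expert review).
-/

open Summit.ResolutionOfSingularities.ResolutionOfSingularities.Theses.FrobeniusClosing (IsolatedForcedTermination)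
open Literature.AlgebraicGeometry.Resolution (IsAbhyankarPlace FGOver exists_ringKrullDim_eq_and_trdeg_eq
  trdeg_eq_trdeg_of_isFractionRing locAtCentre IsQuadraticTransformAlong SubringDominates IsRsopPart
  LocalUniformization3 RelLocalUniformization CossartPiltant2019General)
open Summit.ResolutionOfSingularities.ResolutionOfSingularities.Theorems.SteerRankThinness
  (HasProperCoarsening concl_of_hasProperCoarsening rankOne_of_not_hasProperCoarsening)
open Summit.ResolutionOfSingularities.ResolutionOfSingularities.Theorems.PfaffLine

set_option linter.dupNamespace false

namespace Summit.ResolutionOfSingularities.ResolutionOfSingularities.Theorems.SwitchingDichotomy.Words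

section SteeredTwo

open IsLocalRing
open Literature.AlgebraicGeometry.Resolution (IsLocalBlowupAlong IsQuadraticTransform IsExcellentRing)

variable {K : Type} [Field K]


/-! ### §σ2.19 [tri-2's own numbering: §σ2.17] (res-L0-w41-tri-2 g3, TRIAGER 2 — FIRST-STEP audit of the regime re-cut §σ2.15 / §σ2.16; OURS, hand-derived in
characteristic 2, AI reasoning weaker than expert review; candidates, not facts):
**«LOW ORDER IS ABSORBING» at p = 2** and the resulting SHARPENING of the regime pair.

INSERTION RECIPE (holder only): replace the line `end SteeredTwo` of `L/w41/Steer_r23_plus_mini.lean` (ab1ef1abe589cdd2, l.2216) by the body of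
this file (it re-closes the section); composes with strat-2's §σ2.16 delta (disjoint names). Certified copy: `L/res-L0-w41-tri-2/s17/Steer_r23_plus_mini_plus_tri2.lean`.

ONE-STEP LEMMA `lowOrder_step_two` (stub candidate, S–M): along a 2-steered run with regular 4-dimensional members and perfect residue fields,
`¬ IsHighOrderAt R s 2 i → ¬ IsHighOrderAt R s 2 (i + 1)` — once the cleaned order is exactly 2 it stays exactly 2 (or the run exits, which is
also `¬ IsHighOrderAt`). Hand proof. Let F := (s i)² − g² ∈ (P i)² for the run's cleaner g and q := in₂ F; `¬ High i` says q is not a square of a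
linear form modulo 𝔪ᵢ³, i.e. the polar (alternating) form b_q ≠ 0, rank 2 or 4 (n = 4). Intrinsic reformulation used throughout (perfect residue
field κ, char 2, R regular so R/𝔪³ = κ[y]/(y)³ with its unique coefficient field): `IsHighOrderAt` ⟺ (∃ b, F − b² ∈ 𝔪²) ∧ polar(in₂(F − b²)) = 0,
and this is preserved AND reflected by residually-separable local-étale extensions — so a non-κ-rational closed point of the exceptional fibre is
handled by a finite separable base change making the direction c rational (TYPING CAVEAT C-κ, common to B7/B8/B10/B11 and this lemma; B1/B4 are
direction-free). Cases by the height h of the centre P i (regular, F ∈ (P i)², so q ∈ Sym²(in₁ P i) and rank b_q ≤ h; h = 1 would make q a square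
form and F − (unit·u)² ∈ 𝔪³, i.e. High — excluded):
 • h = 4 (point step, direction c, chart x₀): (s (i+1))² = F/x₀² = q(c) + [b_q(c, y′) + C(c)·x₀] + [q(y′) + x₀·D¹C_c(y′) + F₄(c)·x₀²] + …; squares of
   R (i+1) have no odd-degree parts, so a non-zero linear part gives cleaned order ≤ 1 (`¬ High`); a zero linear part forces c ∈ rad b_q (b_q(c,c) = 0
   and y′ spans a complement of c), hence rank 2, q ≡ ℓ₁ℓ₂, ℓ₁(c) = ℓ₂(c) = 0, and then ℓ₁|_{y′}, ℓ₂|_{y′} stay independent (a relation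
   aℓ₁ + bℓ₂ = λ·y_chart evaluated at c gives λ = 0), so polar(in₂) ∋ ℓ₁ ∧ ℓ₂ ≠ 0: `¬ High (i+1)`.
 • h = 2, 3 (q ≡ ℓ₁ℓ₂ with ℓ₁, ℓ₂ ∈ in₁ P i — strat-2 B9; write P i = (z₁, z₂[, w]) with in₁ z_j = ℓ_j, F = Σ F_ab z_a z_b, F₁₂(0) = 1,
   other mixed F_ab(0) = 0): in R (i+1) = R[P/x]_𝔫 with x the exceptional parameter, F/x² = Σ F_ab z_a′ z_b′ (z′ = z/x). If some z_j′ is a unit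
   (an ℓ-chart) the term F₁₂ z₁′z₂′ contributes a regular parameter linearly: cleaned order ≤ 1, `¬ High`. Otherwise (w-chart, h = 3, z₁′, z₂′ ∈ 𝔫
   after translating by the — rational, see C-κ — direction): in₂(F/x²) ∋ z̄₁′ z̄₂′ with z̄₁′, z̄₂′, x̄ part of a basis of 𝔫/𝔫², polar ≠ 0: `¬ High (i+1)`.
   (h = 2 has no w-chart: both generators cannot lie in 𝔫 since P·R (i+1) = x·R (i+1) with x ∈ P of maximal value ⇒ some z_j/x is a unit.) ∎
CONSEQUENCES (pure logic, kernel-checked below): HIGH may assume `∀ i, IsHighOrderAt R s p i` (high from stage 0: the High half only concerns core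
data whose radicand has cleaned order ≥ 3 at the centre of O on EVERY model of the run), and LOW's «order 2 infinitely often» may assume «order 2
from some stage on» — exactly the entry condition of idea-3 card 3's splitting dictionary (f ≃ ỹ₁ỹ₂ + h(ỹ₃, ỹ₄) from ONE stage on). Equivalent
reading: the polar rank of the cleaned quadratic part is monotone non-decreasing along the run (0 ↦ {0, 2, 4}, 2 ↦ {2, 4}, 4 ↦ exit) — CONCURS
with idea-3 «hyperbolic-splitting-p2» (i)/(iv) and strat-2 B10 («LOW regime from then on»), derived here independently for every step type.
Recorded-inhabitant check (K41f-INHABITANT.md §4b, D₂′ `x z w³ + y^N` under σ_top): cleaned orders 5, 3, 2, exit — regimes H, H, L, — ✓. -/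

/- (holder, r25) tri-2's one-step lemma `lowOrder_step_two` (S–M, the only `sorry` of the delta) is a TREE task —
plan-1 RULING 11/15 DEAL (res-type-062 → res-D-pv-028): `Theorems/FrobeniusClosingSteerLowOrderAbsorbing.lean`; it enters the two
sharpening leaves below as the hypothesis `step` and is replaced BY NAME when it lands. -/

/-- Once low, low for ever (pure logic from a one-step hypothesis; any `p`). OURS. [folklore] -/
theorem lowOrder_from (R : ℕ → Subring K) (s : ℕ → K) (p : ℕ)
    (step : ∀ j, ¬ IsHighOrderAt R s p j → ¬ IsHighOrderAt R s p (j + 1))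
    {i : ℕ} (h : ¬ IsHighOrderAt R s p i) : ∀ j, i ≤ j → ¬ IsHighOrderAt R s p j := by
  intro j hij
  induction j, hij using Nat.le_induction with
  | base => exact h
  | succ j _ ih => exact step j ih

/-- HIGH sharpening: «eventually always high» ⟹ «high at every stage» (pure logic from the one-step hypothesis). OURS. [folklore] -/
theorem highOrder_all_of_eventually (R : ℕ → Subring K) (s : ℕ → K) (p : ℕ)
    (step : ∀ j, ¬ IsHighOrderAt R s p j → ¬ IsHighOrderAt R s p (j + 1))
    (hev : ∃ i₀ : ℕ, ∀ i, i₀ ≤ i → IsHighOrderAt R s p i) : ∀ i, IsHighOrderAt R s p i := by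
  obtain ⟨i₀, hi₀⟩ := hev
  intro i
  by_contra h
  exact lowOrder_from R s p step h (max i i₀) (le_max_left _ _) (hi₀ (max i i₀) (le_max_right _ _))

/-- LOW sharpening: «low infinitely often» ⟹ «eventually always low» (pure logic from the one-step hypothesis). OURS. [folklore] -/
theorem lowOrder_eventually_of_io (R : ℕ → Subring K) (s : ℕ → K) (p : ℕ)
    (step : ∀ j, ¬ IsHighOrderAt R s p j → ¬ IsHighOrderAt R s p (j + 1))
    (hio : ∀ i₀ : ℕ, ∃ i, i₀ ≤ i ∧ ¬ IsHighOrderAt R s p i) :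
    ∃ i₀ : ℕ, ∀ i, i₀ ≤ i → ¬ IsHighOrderAt R s p i := by
  obtain ⟨i₁, -, h⟩ := hio 0
  exact ⟨i₁, lowOrder_from R s p step h⟩

/-- **HIGH half, sharpened entry**: given the one-step lemma at the `CoreDatum` level, the High half need only treat runs that are high-order at
EVERY stage. Pure logic; shows the holder where `lowOrder_step_two` plugs in (no new `def`). OURS. [folklore] -/
theorem highOrderTailConclTwo_of_forall
    (step : ∀ p : ℕ, p = 2 →
      ∀ (k K : Type) [Field k] [CharP k p] [PerfectField k] [Field K] [Algebra k K]
      (O : ValuationSubring K) (A₀ : Subalgebra k K) (h₀ : A₀.toSubring ≤ O.toSubring) (t : K),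
      CoreDatum p 4 k K O A₀ h₀ t →
      ∀ (R : ℕ → Subring K) (P : (i : ℕ) → Ideal (R i)) (s : ℕ → K),
        R 0 = locAtCentre A₀.toSubring O → IsSteeredRun O R P t p s →
        ∀ i, ¬ IsHighOrderAt R s p i → ¬ IsHighOrderAt R s p (i + 1))
    (hAll : ∀ p : ℕ, p = 2 →
      ∀ (k K : Type) [Field k] [CharP k p] [PerfectField k] [Field K] [Algebra k K]
      (O : ValuationSubring K) (A₀ : Subalgebra k K) (h₀ : A₀.toSubring ≤ O.toSubring) (t : K),
      CoreDatum p 4 k K O A₀ h₀ t → ¬ HasProperCoarsening O →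
      ∀ (R : ℕ → Subring K) (P : (i : ℕ) → Ideal (R i)) (s : ℕ → K),
        R 0 = locAtCentre A₀.toSubring O → IsSteeredRun O R P t p s →
        (¬ ∃ i₀ c : ℕ, 1 ≤ c ∧ IsDominantTail R P i₀ c) →
        (∀ i, IsHighOrderAt R s p i) → Concl O A₀ t) :
    HighOrderTailConclTwo := by
  intro p hp k K _ _ _ _ _ O A₀ h₀ t hcore hrk R P s hR0 hrun hnd hev
  exact hAll p hp k K O A₀ h₀ t hcore hrk R P s hR0 hrun hnd
    (highOrder_all_of_eventually R s p (step p hp k K O A₀ h₀ t hcore R P s hR0 hrun) hev)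

/-- **LOW half, sharpened entry**: given the one-step lemma at the `CoreDatum` level, the Low half need only treat runs that are low-order
(cleaned order exactly 2) FROM SOME STAGE ON — the splitting dictionary's entry condition. Pure logic. OURS. [folklore] -/
theorem lowOrderTailConclTwo_of_eventually
    (step : ∀ p : ℕ, p = 2 →
      ∀ (k K : Type) [Field k] [CharP k p] [PerfectField k] [Field K] [Algebra k K]
      (O : ValuationSubring K) (A₀ : Subalgebra k K) (h₀ : A₀.toSubring ≤ O.toSubring) (t : K),
      CoreDatum p 4 k K O A₀ h₀ t →
      ∀ (R : ℕ → Subring K) (P : (i : ℕ) → Ideal (R i)) (s : ℕ → K),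
        R 0 = locAtCentre A₀.toSubring O → IsSteeredRun O R P t p s →
        ∀ i, ¬ IsHighOrderAt R s p i → ¬ IsHighOrderAt R s p (i + 1))
    (hEv : ∀ p : ℕ, p = 2 →
      ∀ (k K : Type) [Field k] [CharP k p] [PerfectField k] [Field K] [Algebra k K]
      (O : ValuationSubring K) (A₀ : Subalgebra k K) (h₀ : A₀.toSubring ≤ O.toSubring) (t : K),
      CoreDatum p 4 k K O A₀ h₀ t → ¬ HasProperCoarsening O →
      ∀ (R : ℕ → Subring K) (P : (i : ℕ) → Ideal (R i)) (s : ℕ → K),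
        R 0 = locAtCentre A₀.toSubring O → IsSteeredRun O R P t p s →
        (¬ ∃ i₀ c : ℕ, 1 ≤ c ∧ IsDominantTail R P i₀ c) →
        (∃ i₀ : ℕ, ∀ i, i₀ ≤ i → ¬ IsHighOrderAt R s p i) → Concl O A₀ t) :
    LowOrderTailConclTwo := by
  intro p hp k K _ _ _ _ _ O A₀ h₀ t hcore hrk R P s hR0 hrun hnd hio
  exact hEv p hp k K O A₀ h₀ t hcore hrk R P s hR0 hrun hnd
    (lowOrder_eventually_of_io R s p (step p hp k K O A₀ h₀ t hcore R P s hR0 hrun) hio)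

/-
R2TwoSigma-s22-strat2.r25.delta.lean — res-L0-w41-strat-2 (planner, CRUX-STRATEGIST, W4.1), 2026-08-27.
§σ2.22 THE THREAD SPLIT for the skeleton of record `L/res-L0-w41-lead-1/Steer_r25.lean` (sha16 e2569b963eb3e939, REGISTERED 08:24:06Z).

INSERTION RECIPE (holder res-L0-w41-lead-1 only): paste the BODY below (everything after this comment) immediately BEFORE the line
`end SteeredTwo` of Steer_r25.lean (l.3257). No new imports. New names only (IsHitStep, IsFinitelyHit, FinitelyHitThreadTwoN, HitHeightLtTwoN,
wanderForestKoenig_graded, threadWanderTwoN_of_split, threadWanderTwoN_of_split_debts, eternalSteeredRunTwo_of_normalised_thread_debts).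
CERTIFIED COMBO: strat-2 folder `Steer_r25_plus_s22.lean` (= r25 + this body at that spot): lean check rc 0 · 0 errors · sorries 6 = r25's
registered six (stub_cp2019General, stub_R2OddHigh, stub_eternalSteeredRunTwo, stub_compositeRankSS, stub_eternalCyclesSSM, stub_nonSwitchingCoreM),
0 in this block; 0 warnings in this block.

HANDS (plan-1 RULING 16c as amended 08:30:44Z, pv-011 THREAD ROUTE 08:24:46Z CONFIRMED): T-i `FinitelyHitThreadTwoN` → res-D-pv-011 AS stub-7
(their Θ1); Θ2 `HitHeightLtTwoN` (S) → the hand plan-1 names (16c's T-ii hand); (K) graded König and the Θ3 induction are PROVED here.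
OURS; candidates behind the two Props, not facts; AI review weaker than expert review.
-/
/-! ### §σ2.22 (res-L0-w41-strat-2, 2026-08-27T09:0xZ; plan-1 RULING 16c «your next typed object = THE THREAD SPLIT» + res-D-pv-011 AS stub-7's
THREAD ROUTE 08:24:46Z, CONFIRMED 08:30:44Z) — THE THREAD SPLIT. `ThreadWanderTwoN` («an infinite thread forces infinitely many births or
infinite branching») ⇐ TWO prover pieces + K(1..3), with the graded König bookkeeping and the induction on the height PROVED IN PLACE:
* T-i `FinitelyHitThreadTwoN` (L, res-D-pv-011 Θ1 `thread_finitelyHit_not_noEternalChain`): an infinite thread hit only finitely often is an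
  eternal isolated radicand chain of the `c`-dimensional germ at the thread's generic point (quadratic transforms at the visits, isomorphisms of
  the germ torsor in between — non-hit centres miss the generic point, the strict step rescales the generator by a unit), `1 ≤ c ≤ 3`;
* Θ2 `HitHeightLtTwoN` (S, height bookkeeping): positive centres have height `≤ 3`, and a HIT between two visits is a positive step of height
  strictly below the thread's (`P m ⊊ W_m`, `ht W_m ≤ c` by the dimension inequality over the earlier visit);
* in-file: `wanderForestKoenig_graded` (König per height, from `koenig_nat`) and the kernel `threadWanderTwoN_of_split` (strong induction on the
  height: finitely hit ⇒ T-i ⊥ K(c); infinitely hit ⇒ infinitely many positive steps of smaller height ⇒ pigeonhole ⇒ graded König ⇒ a lower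
  thread). RULING 16c's T-ii («height ≤ 2 threads are finite») and T-iii («curve thread hit by surfaces i.o.») are SUBSUMED: divisor threads are
  never hit, every hit is absorbed by births / branching / the induction — no «divisor hit resolves the generic point» lemma and no «regular stays
  regular» bookkeeping (pv-011's CORRECTION to STRAT2-MEMO-1 §6″ (F-b)(ii) accepted and moot). OURS (candidates behind the two Props; the glue is
  kernel-checked; AI review weaker than expert review). -/

/-- OURS (strat-2; res-D-pv-011's «`P m ⊆ W_m`»): stage `m` HITS the thread through its later member `j` — `m < j`, `m` is NOT itself an
ancestor of `j`, and the centre at `m` contains `W_m := comap (P j)`, the image of `j`'s centre in `R m` (so the blow-up at `m` changes the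
germ at `W_m`; point steps and non-hit positive steps are isomorphisms at the generic point of `V(W_m)`). -/
def IsHitStep (R : ℕ → Subring K) (P : (i : ℕ) → Ideal (R i)) (m j : ℕ) : Prop :=
  m < j ∧ ¬ IsAncestorStep R P m j ∧ ∃ h : R m ≤ R j, P m ≤ Ideal.comap (Subring.inclusion h) (P j)

/-- OURS (strat-2): the thread `J` is hit only finitely often (no hits from some stage on, through any member of `J`). -/
def IsFinitelyHit (R : ℕ → Subring K) (P : (i : ℕ) → Ideal (R i)) (J : Set ℕ) : Prop :=
  ∃ m₀ : ℕ, ∀ m, m₀ ≤ m → m ∉ J → ∀ j ∈ J, ¬ IsHitStep R P m j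

/-- **T-i · FinitelyHitThreadTwoN** (L; res-D-pv-011 AS stub-7, Θ1 `thread_finitelyHit_not_noEternalChain`; dischargeable modulo nothing —
the conclusion NEGATES K(c), which the kernel then contradicts with K(1) (p500126) / Lipman (K(2)) / CP2019-branch (K(3))): along a normalised
2-steered run, an infinite set `J` of pairwise ancestral positive stages (a THREAD) that is hit only finitely often yields an ETERNAL ISOLATED
RADICAND CHAIN in dimension `c ∈ {1, 2, 3}` (= the thread's height): members = the germs `(R j)_{P j}` at the visits `j ∈ J` beyond the last hit,
steps = quadratic transforms (G's dictionary p503815 / p506813 with identity steps allowed: a non-hit stage is an isomorphism of the germ torsor —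
the centre misses the generic point of `V(W_m)`, `x_m ∉ W_{m+1}`, the strict step `s ↦ (s − g)/x` rescales the generator by a unit), isolated at
every visit (a σ_top centre is a MINIMAL singular prime), `1 ≤ c` (`⊥` is never singular: generic fibre a field) and `c ≤ 3` (centres are not
the closed point; members have dimension 4). Why it might fail: the isolatedness / `f − g^p ∈ P^p` bookkeeping of `NoEternalIsolatedRadicandChain`
at NON-closed points after identity steps (HLOST §3 shape). OURS. (folklore) -/
def FinitelyHitThreadTwoN : Prop :=
  ∀ p : ℕ, p = 2 →
    ∀ (k K : Type) [Field k] [CharP k p] [PerfectField k] [Field K] [Algebra k K]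
    (O : ValuationSubring K) (A₀ : Subalgebra k K) (h₀ : A₀.toSubring ≤ O.toSubring) (t : K),
    CoreDatum p 4 k K O A₀ h₀ t → ¬ HasProperCoarsening O →
    ∀ (R : ℕ → Subring K) (P : (i : ℕ) → Ideal (R i)) (s : ℕ → K),
      R 0 = locAtCentre A₀.toSubring O → NormalAt O (R 0) p t → IsSteeredRun O R P t p s →
      ∀ J : Set ℕ, J.Infinite → (∀ i ∈ J, ∀ j ∈ J, i < j → IsAncestorStep R P i j) → IsFinitelyHit R P J →
      ∃ c : ℕ, 1 ≤ c ∧ c ≤ 3 ∧ ¬ NoEternalIsolatedRadicandChain p c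

/-- **Θ2 · HitHeightLtTwoN** (S; height bookkeeping along a steered run, res-D-pv-011's Θ2 + the height bound of positive centres):
(a) every positive-dimensional centre has height `≤ 3` (it is a non-maximal prime of a 4-dimensional regular local ring — `RunHygieneTwo`
p512522 + M p501181); (b) if `i < m < j` with `i` an ancestor of `j` and `m` a HIT of `j`, then `m` is a positive step of height STRICTLY
BELOW `j`'s: `W_m := comap (P j) ≠ 𝔪_m` (its contraction to `R i` is `P i ≠ 𝔪_i`, by domination), `P m ⊊ W_m` (equality plus `ht W_m = ht P j`
would make `m` an ancestor), and `ht W_m ≤ ht P i = ht P j` by the dimension inequality for the birational extension `R i ⊆ R m` of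
local domains essentially of finite type (`ht W_m + trdeg κ(W_m)/κ(P i) ≤ ht P i`). Why it might fail: only the e.f.t./universally-catenary
plumbing of the members (tree `…SteerMemberDimension`). OURS. (folklore) -/
def HitHeightLtTwoN : Prop :=
  ∀ p : ℕ, p = 2 →
    ∀ (k K : Type) [Field k] [CharP k p] [PerfectField k] [Field K] [Algebra k K]
    (O : ValuationSubring K) (A₀ : Subalgebra k K) (h₀ : A₀.toSubring ≤ O.toSubring) (t : K),
    CoreDatum p 4 k K O A₀ h₀ t → ¬ HasProperCoarsening O →
    ∀ (R : ℕ → Subring K) (P : (i : ℕ) → Ideal (R i)) (s : ℕ → K),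
      R 0 = locAtCentre A₀.toSubring O → NormalAt O (R 0) p t → IsSteeredRun O R P t p s →
      (∀ j, IsPosStep R P j → (P j).height ≤ 3) ∧
      (∀ i m j : ℕ, IsAncestorStep R P i j → i < m → IsHitStep R P m j →
        IsPosStep R P m ∧ (P m).height < (P j).height)

/-- **GRADED KÖNIG** (PROVED; res-D-pv-011's (K)): infinitely many positive steps OF ONE HEIGHT `h`, finitely many births and finite branching
force an infinite thread of height `h`. From `koenig_nat` with `S = {positive steps of height h}`, `A i j = ancestry ∧ ht (P j) = h`: graded
roots are roots and graded children are children, because ancestry preserves the height. OURS. [folklore] -/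
theorem wanderForestKoenig_graded (R : ℕ → Subring K) (P : (i : ℕ) → Ideal (R i)) (hmono : Monotone R) (h : ℕ∞)
    (hinf : {j | IsPosStep R P j ∧ (P j).height = h}.Infinite) (hroots : {j | IsRootStep R P j}.Finite)
    (hbr : ∀ i, {j | IsChildStep R P i j}.Finite) :
    ∃ J : Set ℕ, J.Infinite ∧ (∀ i ∈ J, ∀ j ∈ J, i < j → IsAncestorStep R P i j) ∧ ∀ j ∈ J, (P j).height = h := by
  obtain ⟨J, hJ, hA⟩ := _root_.Summit.ResolutionOfSingularities.ResolutionOfSingularities.Theorems.SwitchingDichotomy.ThreadChain.koenig_nat (A := fun i j => IsAncestorStep R P i j ∧ (P j).height = h)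
    (S := {j | IsPosStep R P j ∧ (P j).height = h})
    (fun hij => hij.1.1)
    (fun hij => ⟨hij.1.2.1, hij.1.2.2.2.1.symm.trans hij.2⟩)
    (fun h₁ h₂ => ⟨isAncestorStep_trans R P h₁.1 h₂.1, h₂.2⟩)
    (fun hij h₁ h₂ => ⟨isAncestorStep_of_common_descendant R P hmono hij h₁.1 h₂.1, h₂.1.2.2.2.1.symm.trans h₂.2⟩)
    hinf
    (hroots.subset fun j hj => ⟨hj.1.1, fun i hi => hj.2 i ⟨hi, hj.1.2⟩⟩)
    (fun i => (hbr i).subset fun j hj => ⟨hj.1.1, fun k hk => hj.2 k ⟨hk, hj.1.2⟩⟩)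
  refine ⟨J, hJ, fun i hi j hj hij => (hA i hi j hj hij).1, fun j hj => ?_⟩
  obtain ⟨l, hl, hjl⟩ := hJ.exists_gt j
  obtain ⟨hanc, hlh⟩ := hA j hj l hl hjl
  exact hanc.2.2.2.1.symm.trans hlh

/-- **THE THREAD SPLIT — kernel** (PROVED): `ThreadWanderTwoN` ⇐ T-i + Θ2 + K(1) + K(2) + K(3). Assume neither infinitely many births nor
infinite branching. By strong induction on `n`: no infinite thread with heights `≤ n`. Finitely hit ⇒ T-i gives `¬ K(c)`, `c ∈ {1,2,3}` —
contradiction; infinitely hit ⇒ the hits above a fixed member are positive steps of height `< n` (Θ2 (b)), an infinite set, so by pigeonhole some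
height `h' < n` carries infinitely many positive steps, and graded König yields an infinite thread of height `h'` — contradiction by induction.
The given thread has heights `≤ 3` (Θ2 (a)). OURS. [folklore] -/
theorem threadWanderTwoN_of_split (hTi : FinitelyHitThreadTwoN) (hH : HitHeightLtTwoN)
    (hK1 : ∀ p : ℕ, p.Prime → NoEternalIsolatedRadicandChain p 1)
    (hK2 : ∀ p : ℕ, p.Prime → NoEternalIsolatedRadicandChain p 2)
    (hK3 : ∀ p : ℕ, p.Prime → NoEternalIsolatedRadicandChain p 3) : ThreadWanderTwoN := by
  intro p hp2 k K _i1 _i2 _i3 _i4 _i5 O A₀ h₀ t core hrk R P s hR0 hN hrun _hnd _hhigh hthr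
  have hp : p.Prime := hp2 ▸ Nat.prime_two
  by_contra hcon
  have hroots : {j | IsRootStep R P j}.Finite := Set.not_infinite.mp fun h => hcon (Or.inl h)
  have hbr : ∀ i, {j | IsChildStep R P i j}.Finite := fun i => Set.not_infinite.mp fun h => hcon (Or.inr ⟨i, h⟩)
  have hmono : Monotone R := hrun.monotone
  obtain ⟨hle3, hhit⟩ := hH p hp2 k K O A₀ h₀ t core hrk R P s hR0 hN hrun
  have main : ∀ n : ℕ, ∀ J : Set ℕ, J.Infinite → (∀ i ∈ J, ∀ j ∈ J, i < j → IsAncestorStep R P i j) →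
      (∀ j ∈ J, (P j).height ≤ (n : ℕ∞)) → False := by
    intro n
    induction n using Nat.strong_induction_on with
    | _ n ih =>
      intro J hJ hA hle
      by_cases hfin : IsFinitelyHit R P J
      · obtain ⟨c, hc1, hc3, hK⟩ := hTi p hp2 k K O A₀ h₀ t core hrk R P s hR0 hN hrun J hJ hA hfin
        interval_cases c
        · exact hK (hK1 p hp)
        · exact hK (hK2 p hp)
        · exact hK (hK3 p hp)
      · obtain ⟨j₀, hj₀⟩ := hJ.nonempty
        -- the positive steps of height `< n` form an infinite set (else the thread is finitely hit)
        have hH' : {m | IsPosStep R P m ∧ (P m).height < (n : ℕ∞)}.Infinite := by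
          refine Set.infinite_of_not_bddAbove ?_
          rintro ⟨b, hb⟩
          apply hfin
          refine ⟨max b j₀ + 1, fun m hm _ j hj hmj => ?_⟩
          have hj₀m : j₀ < m := by omega
          have hA₀ : IsAncestorStep R P j₀ j := hA j₀ hj₀ j hj (lt_trans hj₀m hmj.1)
          obtain ⟨hpos, hlt⟩ := hhit j₀ m j hA₀ hj₀m hmj
          have hmb : m ≤ b := hb ⟨hpos, lt_of_lt_of_le hlt (hle j hj)⟩
          omega
        -- pigeonhole over the heights `h' < n`
        have hex : ∃ h' : ℕ, h' < n ∧ {m | IsPosStep R P m ∧ (P m).height = (h' : ℕ∞)}.Infinite := by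
          by_contra hno
          have hfin' : ∀ h' : ℕ, h' < n → {m | IsPosStep R P m ∧ (P m).height = (h' : ℕ∞)}.Finite :=
            fun h' hh' => Set.not_infinite.mp fun hi => hno ⟨h', hh', hi⟩
          apply hH'
          have hU : (⋃ h' ∈ (↑(Finset.range n) : Set ℕ), {m | IsPosStep R P m ∧ (P m).height = (h' : ℕ∞)}).Finite :=
            Set.Finite.biUnion (Finset.range n).finite_toSet fun h' hh' =>
              hfin' h' (Finset.mem_range.mp (Finset.mem_coe.mp hh'))
          refine hU.subset ?_
          rintro m ⟨hpos, hlt⟩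
          obtain ⟨h', hh'⟩ := ENat.ne_top_iff_exists.mp hlt.ne_top
          have hh'n : h' < n := by
            rw [← hh'] at hlt
            exact_mod_cast hlt
          exact Set.mem_biUnion (Finset.mem_coe.mpr (Finset.mem_range.mpr hh'n)) ⟨hpos, hh'.symm⟩
        obtain ⟨h', hh'n, hinf⟩ := hex
        obtain ⟨J', hJ', hA', hh'⟩ := wanderForestKoenig_graded R P hmono h' hinf hroots hbr
        exact ih h' hh'n J' hJ' hA' fun j hj => (hh' j hj).le
  obtain ⟨J, hJ, hA⟩ := hthr
  refine main 3 J hJ hA fun j hj => ?_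
  obtain ⟨l, hl, hjl⟩ := hJ.exists_gt j
  exact_mod_cast hle3 j (hA j hj l hl hjl).2.1

/-- **THREAD is CLOSED modulo T-i, Θ2 and the two named facts** (r25 currency: K(1) proved p500126, K(2) ⇐ Lipman 1978, K(3) ⇐ CP2019 branch).
Pure logic. OURS. [folklore] -/
theorem threadWanderTwoN_of_split_debts (hTi : FinitelyHitThreadTwoN) (hH : HitHeightLtTwoN)
    (hL : Literature.AlgebraicGeometry.Resolution.Lipman1978NoEternalNormalBranch.{0})
    (hCP : Literature.AlgebraicGeometry.Resolution.CossartPiltant2019HironakaLUIsolatedBranch.{0}) : ThreadWanderTwoN :=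
  threadWanderTwoN_of_split hTi hH noEternalIsolatedRadicandChain_one_holds
    (noEternalIsolatedRadicandChain_two_of_lipman hL) (noEternalIsolatedRadicandChain_three_of_CP hCP)

/-- **T after the thread split (r25 form)**: T ⇐ NormalisedStart, PointTailHigh, T-i, Θ2, BIRTHS, BRANCHING, LOWᴺ + the two named facts.
Pure logic. OURS. [folklore] -/
theorem eternalSteeredRunTwo_of_normalised_thread_debts (hNS : NormalisedStartTwo)
    (hP : PointTailHighConclTwo) (hTi : FinitelyHitThreadTwoN) (hH : HitHeightLtTwoN) (hB : BirthWanderConclTwoN)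
    (hC : BranchWanderConclTwoN) (hLow : LowOrderTailConclTwoN)
    (hL : Literature.AlgebraicGeometry.Resolution.Lipman1978NoEternalNormalBranch.{0})
    (hCP : Literature.AlgebraicGeometry.Resolution.CossartPiltant2019HironakaLUIsolatedBranch.{0}) : EternalSteeredRunTwo :=
  eternalSteeredRunTwo_of_normalised_budget_debts hNS hP (threadWanderTwoN_of_split_debts hTi hH hL hCP) hB hC hLow hL hCP

-- ========================= PART A (before `end SteeredTwo`) =========================

end SteeredTwo

end Summit.ResolutionOfSingularities.ResolutionOfSingularities.Theorems.SwitchingDichotomy.Words
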